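import Literature.Analysis.FluidPDE.DriftDiffusionTypeIDriftBarrier
import HarnessLib

/-!
# Two-point oscillation decay for drift–diffusion with a Type-I drift: THEOREM U and COROLLARY U1, unconditional

Topic `Literature/Analysis/FluidPDE` (family `ns`).  THEOREM U of the experiment cell
`pub/ns-exp-scalarLiouville/MAP.md` rev 2 §2 («folklore-level; not located in print», DATUM A-3), in the
kernel with an explicit NON-SHARP rate: `TypeIDrift.halfLineOUBarrier_explicit` discharges the
one-dimensional profile input of `typeIDrift_twoPoint_oscillation_of_barrier` with the profile `k(ρ) = 1 + (1 − e^{−aρ})/a + k₂ρ`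
(`a = C+1`, `k₂ = e^{−a(8C+4)}/a`), `λ(C) = e^{−(C+1)(8C+4)}/(4(C+1))` (the
MAP's sharp `λ₁(C) ≍ (C/2√π)e^{−C²}` is NOT claimed) and `A = 2 + 2ρ̄`; hence
* `TypeIDrift.typeIDrift_twoPoint_oscillation` — THEOREM U: for `θ ∈ C²` bounded by `M` on `(t₀,0) × E`
  solving `∂ₜθ = Δθ − ⟪b, ∇θ⟫`, `‖b(t,x)‖ ≤ C/√(−t)` (no divergence condition, no regularity of `b`, any
  finite-dimensional `E`), `t₀ < t₁ ≤ t < 0`, `‖x − y‖ ≤ 2ρ̄√(−t)`: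
  `|θ(t,x) − θ(t,y)| ≤ 2M(2 + 2ρ̄)(t/t₁)^{λ(C)}`;
* `TypeIDrift.typeIDrift_ancient_slice_constant` — COROLLARY U1: a bounded `C²` ANCIENT solution
  (`t₀ = −∞`) is constant on every time slice.
* `TypeIDrift.typeIDrift_ancient_constant` — COROLLARY U1, space–time form: such a solution is constant on
  `(−∞,0) × E` (slice constancy + the equation ⇒ `∂ₜθ = 0`). [appended 2026-08-28, ARM A g3]
(COR U2 — KNSS Thm 5.2 in the Type-I subclass via `η = ω_θ/ρ` in `ℝ⁵` — is not attempted here.)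
WHAT THIS IS NOT: a statement about the LINEAR model `(SL)` `∂ₜθ + b·∇θ = Δθ` only; nothing here proves or refutes
`stub_scalarLiouville`, `PoloidalLiouville` (stmt-NavierStokesRegularity-1222) or Navier–Stokes regularity.
References: `pub/ns-exp-scalarLiouville/MAP.md` rev 2 §2 [KochNadirashviliSereginSverak2009, Thm 5.2]
[SereginSilvestreSverakZlatos2012]; proof route: [Kruzkov1970] doubling / [Lieberman1996] Ch. II.
-/

noncomputable section

open Set Function Filter Metric Topology InnerProductSpace
open scoped RealInnerProductSpace Laplacian Topology

namespace Literature.Analysis.FluidPDE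

namespace TypeIDrift

/-! ### §5 An explicit profile: the one-dimensional input discharged (non-sharp rate) -/

section Explicit

/-- **An explicit barrier profile.**  For `C ≥ 0`, `ρ̄ ≥ 0` the profile
`k(ρ) = 1 + (1 − e^{−aρ})/a + k₂ρ`, `a = C + 1`, `k₂ = ε₀/a`, `ε₀ = e^{−a(8C+4)}`, satisfies
the profile hypotheses of `typeIDrift_twoPoint_oscillation_of_barrier` with
`λ = ε₀/(4a) = e^{−(C+1)(8C+4)}/(4(C+1))` and `A = 2 + 2ρ̄`
(any real `ρ̄`):
`4k″ + (2C − ρ/2)k′ + λk ≤ −4e^{−aρ} + k₂(2C + ½ − ρ/4) ≤ 0` (for `ρ ≥ 8C+2` the bracket is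
nonpositive, for `ρ < 8C+2` one has `e^{−aρ} > ε₀ ≥ k₂(2C+½)/2`).  NOT the sharp rate `λ₁(C)` of
`pub/ns-exp-scalarLiouville/MAP.md` Lemma 2.3 (which is `≍ (C/2√π)e^{−C²}`); any positive rate
suffices for the Liouville corollary.
[cite: SereginSilvestreSverakZlatos2012, §2 (one-dimensional comparison profile; explicit non-sharp variant)] -/
theorem halfLineOUBarrier_explicit {C : ℝ} (ρbar : ℝ) (hC : 0 ≤ C) :
    ∃ k k' k'' : ℝ → ℝ, 0 < k 0 ∧ (∀ ρ, HasDerivAt k (k' ρ) ρ) ∧ (∀ ρ, HasDerivAt k' (k'' ρ) ρ) ∧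
      (∀ ρ, 0 ≤ ρ → k 0 ≤ k ρ) ∧ (∀ ρ, 0 < ρ → 0 ≤ k' ρ) ∧
      (∀ ρ, 0 < ρ → 4 * k'' ρ + (2 * C - ρ / 2) * k' ρ
        + (Real.exp (-((C + 1) * (8 * C + 4))) / (4 * (C + 1))) * k ρ ≤ 0) ∧
      (∀ ρ, 0 ≤ ρ → ρ ≤ 2 * ρbar → k ρ ≤ (2 + 2 * ρbar) * k 0) := by
  set a : ℝ := C + 1 with ha
  have ha0 : 0 < a := by rw [ha]; linarith
  have ha1 : 1 ≤ a := by rw [ha]; linarith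
  set ε₀ : ℝ := Real.exp (-(a * (8 * C + 4))) with hε₀
  have hε₀0 : 0 < ε₀ := Real.exp_pos _
  have hε₀1 : ε₀ ≤ 1 := by
    rw [hε₀, Real.exp_le_one_iff]
    have : 0 ≤ a * (8 * C + 4) := by positivity
    linarith
  set k₂ : ℝ := ε₀ / a with hk₂
  have hk₂0 : 0 < k₂ := div_pos hε₀0 ha0
  have hk₂1 : k₂ ≤ 1 := by
    rw [hk₂, div_le_one ha0]; linarith
  have hk₂ε : k₂ ≤ ε₀ := by
    rw [hk₂, div_le_iff₀ ha0]; nlinarith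
  set lam : ℝ := ε₀ / (4 * a) with hlam
  have hlam0 : 0 < lam := by positivity
  have hlamk : lam = k₂ / 4 := by rw [hlam, hk₂]; field_simp
  refine ⟨fun ρ => 1 + (1 - Real.exp (-(a * ρ))) / a + k₂ * ρ,
    fun ρ => Real.exp (-(a * ρ)) + k₂, fun ρ => -a * Real.exp (-(a * ρ)),
    ?_, ?_, ?_, ?_, ?_, ?_, ?_⟩
  · -- `k(0) = 1 > 0`
    simp
  · -- `k′`
    intro ρ
    have h1 : HasDerivAt (fun ρ' : ℝ => Real.exp (-(a * ρ'))) (Real.exp (-(a * ρ)) * (-a)) ρ := by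
      have := ((hasDerivAt_id ρ).const_mul a).neg.exp
      simpa using this
    have h2 := (((h1.const_sub 1).div_const a).const_add 1).add ((hasDerivAt_id ρ).const_mul k₂)
    refine h2.congr_deriv ?_
    field_simp
  · -- `k″`
    intro ρ
    have h1 : HasDerivAt (fun ρ' : ℝ => Real.exp (-(a * ρ'))) (Real.exp (-(a * ρ)) * (-a)) ρ := by
      have := ((hasDerivAt_id ρ).const_mul a).neg.exp
      simpa using this
    refine (h1.add_const k₂).congr_deriv ?_
    ring
  · -- `k(0) ≤ k(ρ)` for `ρ ≥ 0`
    intro ρ hρ0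
    have h1 : Real.exp (-(a * ρ)) ≤ 1 := by
      rw [Real.exp_le_one_iff]; nlinarith
    have h2 : 0 ≤ (1 - Real.exp (-(a * ρ))) / a := div_nonneg (by linarith) ha0.le
    have h3 : 0 ≤ k₂ * ρ := mul_nonneg hk₂0.le hρ0
    simp only [mul_zero, neg_zero, Real.exp_zero, sub_self, zero_div, add_zero]
    linarith
  · -- `k′ ≥ 0`
    intro ρ _
    positivity
  · -- the profile inequality
    intro ρ hρ0
    set x : ℝ := Real.exp (-(a * ρ)) with hx
    have hx0 : 0 < x := Real.exp_pos _
    -- rewrite the expression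
    have hF : 4 * (-a * x) + (2 * C - ρ / 2) * (x + k₂) + lam * (1 + (1 - x) / a + k₂ * ρ) =
        x * (2 * C - 4 * a - ρ / 2 - lam / a) + (2 * C * k₂ + lam * (1 + 1 / a)) + ρ * k₂ * (lam - 1 / 2) := by
      field_simp
      ring
    rw [hF]
    -- step 1: the `x`-bracket is `≤ −4`
    have s1 : x * (2 * C - 4 * a - ρ / 2 - lam / a) ≤ x * (-4) := by
      apply mul_le_mul_of_nonneg_left _ hx0.le
      have : 0 ≤ lam / a := div_nonneg hlam0.le ha0.le
      rw [ha] at this ⊢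
      linarith
    -- step 2: `λ(1 + 1/a) ≤ 2λ = k₂/2`
    have s2 : lam * (1 + 1 / a) ≤ k₂ / 2 := by
      have h1a : 1 / a ≤ 1 := by rw [div_le_one ha0]; exact ha1
      have : lam * (1 + 1 / a) ≤ lam * 2 := mul_le_mul_of_nonneg_left (by linarith) hlam0.le
      linarith
    -- step 3: `ρ k₂ (λ − 1/2) ≤ −ρ k₂/4`
    have s3 : ρ * k₂ * (lam - 1 / 2) ≤ -(ρ * k₂ / 4) := by
      have hρk : 0 ≤ ρ * k₂ := mul_nonneg hρ0.le hk₂0.le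
      have hl : lam - 1 / 2 ≤ -(1 / 4) := by rw [hlamk]; linarith
      nlinarith
    -- conclusion in the two regimes
    by_cases hbig : 8 * C + 2 ≤ ρ
    · have h4 : 2 * C * k₂ + k₂ / 2 - ρ * k₂ / 4 ≤ 0 := by nlinarith
      nlinarith
    · push Not at hbig
      have hxε : ε₀ < x := by
        rw [hε₀, hx, Real.exp_lt_exp]
        nlinarith
      have h5 : 2 * C * k₂ + k₂ / 2 ≤ 2 * ε₀ := by
        have : 2 * C * k₂ + k₂ / 2 = ε₀ * ((2 * C + 1 / 2) / a) := by rw [hk₂]; field_simp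
        rw [this]
        have h6 : (2 * C + 1 / 2) / a ≤ 2 := by
          rw [div_le_iff₀ ha0, ha]; linarith
        nlinarith
      have h7 : 0 ≤ ρ * k₂ / 4 := by positivity
      nlinarith
  · -- normalisation on `[0, 2ρ̄]`
    intro ρ hρ0 hρ1
    have h1 : (1 - Real.exp (-(a * ρ))) / a ≤ 1 := by
      rw [div_le_one ha0]
      have := Real.exp_pos (-(a * ρ))
      linarith
    have h2 : k₂ * ρ ≤ 1 * (2 * ρbar) := mul_le_mul hk₂1 hρ1 hρ0 zero_le_one
    simp only [mul_zero, neg_zero, Real.exp_zero, sub_self, zero_div, add_zero, mul_one]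
    linarith

end Explicit

/-! ### §6 THEOREM U and COROLLARY U1, unconditional -/

section Unconditional

variable {E : Type*} [NormedAddCommGroup E] [InnerProductSpace ℝ E] [FiniteDimensional ℝ E]

/-- **THEOREM U (two-point oscillation decay for Type-I drifts, unconditional, non-sharp rate).**
Let `θ` be `C²` and bounded by `M` on `(t₀, 0) × E` (`E` any finite-dimensional real inner-product
space), solving `∂ₜθ = Δθ − ⟪b, ∇θ⟫` with a drift of Type-I size `‖b(t,x)‖ ≤ C/√(−t)`, `C ≥ 0` — no
divergence condition, no regularity of `b`.  Then for `t₀ < t₁ ≤ t < 0`, any `ρ̄` and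
`‖x − y‖ ≤ 2ρ̄√(−t)`:  `|θ(t,x) − θ(t,y)| ≤ 2·M·(2 + 2ρ̄)·(t/t₁)^{λ(C)}`,
`λ(C) = e^{−(C+1)(8C+4)}/(4(C+1)) > 0`.
(`pub/ns-exp-scalarLiouville/MAP.md` rev 2 §2 THEOREM U with `A_C(ρ̄)`, `λ₁(C)` replaced by the
explicit non-sharp `2 + 2ρ̄`, `λ(C)`; proof = `typeIDrift_twoPoint_oscillation_of_barrier` +
`halfLineOUBarrier_explicit`.)
[cite: SereginSilvestreSverakZlatos2012, Thm 1.1 (Liouville / oscillation decay for critical drifts — Type-I-in-time variant, no divergence condition)]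
[cite: KochNadirashviliSereginSverak2009, Thm 5.2 (the Type-I axisymmetric no-swirl case it models)] -/
theorem typeIDrift_twoPoint_oscillation {θ : ℝ → E → ℝ} {b : ℝ → E → E} {t₀ C M ρbar : ℝ}
    (hθ : ContDiffOn ℝ 2 (uncurry θ) (Ioo t₀ 0 ×ˢ univ))
    (hM : ∀ t ∈ Ioo t₀ 0, ∀ x, |θ t x| ≤ M) (hC : 0 ≤ C)
    (hb : ∀ t ∈ Ioo t₀ 0, ∀ x, ‖b t x‖ ≤ C / Real.sqrt (-t))
    (heq : ∀ t ∈ Ioo t₀ 0, ∀ x,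
      deriv (fun s => θ s x) t = (Δ (θ t)) x - ⟪b t x, gradient (θ t) x⟫) :
    ∀ t₁ t : ℝ, t₀ < t₁ → t₁ ≤ t → t < 0 → ∀ x y : E,
      ‖x - y‖ ≤ 2 * ρbar * Real.sqrt (-t) →
        |θ t x - θ t y| ≤ 2 * M * (2 + 2 * ρbar) *
          (t / t₁) ^ (Real.exp (-((C + 1) * (8 * C + 4))) / (4 * (C + 1))) := by
  obtain ⟨k, k', k'', hk0, hk1, hk2, hkmono, hk'0, hkin, hkA⟩ := halfLineOUBarrier_explicit ρbar hC
  have hlam : 0 ≤ Real.exp (-((C + 1) * (8 * C + 4))) / (4 * (C + 1)) := by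
    have : 0 < C + 1 := by linarith
    positivity
  exact typeIDrift_twoPoint_oscillation_of_barrier hθ hM hC hb heq hk0 hk1 hk2 hkmono hk'0 hkin hkA hlam

/-- **COROLLARY U1 (Liouville on slices for ancient solutions).**  A bounded `C²` solution of
`∂ₜθ = Δθ − ⟪b, ∇θ⟫` on `(−∞, 0) × E` with a Type-I drift `‖b(t,x)‖ ≤ C/√(−t)` is constant on
every time slice: `θ(t,x) = θ(t,y)` for all `t < 0`, `x, y`.  (Let `t₁ → −∞` in THEOREM U.)
(`pub/ns-exp-scalarLiouville/MAP.md` rev 2 §2 COROLLARY U1, slice form.)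
[cite: SereginSilvestreSverakZlatos2012, Thm 1.1 (Liouville theorem for bounded ancient solutions with critical drift — Type-I-in-time variant)]
[cite: KochNadirashviliSereginSverak2009, Thm 5.2] -/
theorem typeIDrift_ancient_slice_constant {θ : ℝ → E → ℝ} {b : ℝ → E → E} {C M : ℝ}
    (hθ : ContDiffOn ℝ 2 (uncurry θ) (Iio 0 ×ˢ univ))
    (hM : ∀ t, t < 0 → ∀ x, |θ t x| ≤ M) (hC : 0 ≤ C)
    (hb : ∀ t, t < 0 → ∀ x, ‖b t x‖ ≤ C / Real.sqrt (-t))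
    (heq : ∀ t, t < 0 → ∀ x,
      deriv (fun s => θ s x) t = (Δ (θ t)) x - ⟪b t x, gradient (θ t) x⟫) :
    ∀ t, t < 0 → ∀ x y : E, θ t x = θ t y := by
  intro t ht x y
  have hM0 : 0 ≤ M := le_trans (abs_nonneg _) (hM t ht x)
  have hu : 0 < Real.sqrt (-t) := Real.sqrt_pos.2 (by linarith)
  set ρbar : ℝ := ‖x - y‖ / (2 * Real.sqrt (-t)) with hρbar
  have hρ0 : 0 ≤ ρbar := by positivity
  have hsep : ‖x - y‖ ≤ 2 * ρbar * Real.sqrt (-t) := by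
    rw [hρbar]; field_simp; exact le_rfl
  set lam : ℝ := Real.exp (-((C + 1) * (8 * C + 4))) / (4 * (C + 1)) with hlam
  have hlam0 : 0 < lam := by
    have : 0 < C + 1 := by linarith
    positivity
  set D : ℝ := 2 * M * (2 + 2 * ρbar) with hD
  have hD0 : 0 ≤ D := by positivity
  -- `|θ t x − θ t y| ≤ δ` for every `δ > 0`
  have key : ∀ δ : ℝ, 0 < δ → |θ t x - θ t y| ≤ δ := by
    intro δ hδ
    -- choose `t₁ ≤ t` with `D (t/t₁)^λ ≤ δ`
    set m : ℝ := min ((δ / (D + 1)) ^ (1 / lam)) 1 with hm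
    have hq0 : 0 < δ / (D + 1) := div_pos hδ (by linarith)
    have hm0 : 0 < m := lt_min (Real.rpow_pos_of_pos hq0 _) one_pos
    have hm1 : m ≤ 1 := min_le_right _ _
    set t₁ : ℝ := t / m with ht₁
    have ht₁t : t₁ ≤ t := by
      rw [ht₁, div_le_iff₀ hm0]; nlinarith
    have ht₁0 : t₁ < 0 := lt_of_le_of_lt ht₁t ht
    have hθ' : ContDiffOn ℝ 2 (uncurry θ) (Ioo (t₁ - 1) 0 ×ˢ univ) :=
      hθ.mono (prod_mono Ioo_subset_Iio_self le_rfl)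
    have h := typeIDrift_twoPoint_oscillation (t₀ := t₁ - 1) (C := C) (M := M) (ρbar := ρbar) hθ'
      (fun s hs => hM s hs.2) hC (fun s hs => hb s hs.2) (fun s hs => heq s hs.2)
      t₁ t (by linarith) ht₁t ht x y hsep
    have hquot : t / t₁ = m := by
      rw [ht₁, div_div_eq_mul_div, mul_comm, mul_div_assoc, div_self ht.ne, mul_one]
    rw [hquot, ← hlam] at h
    have hmpow : m ^ lam ≤ δ / (D + 1) := by
      have h1 : m ^ lam ≤ ((δ / (D + 1)) ^ (1 / lam)) ^ lam :=
        Real.rpow_le_rpow hm0.le (min_le_left _ _) hlam0.le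
      rw [← Real.rpow_mul hq0.le, one_div_mul_cancel hlam0.ne', Real.rpow_one] at h1
      exact h1
    have hDq : D * (δ / (D + 1)) ≤ δ := by
      rw [mul_div_assoc']
      rw [div_le_iff₀ (by linarith)]
      nlinarith
    calc |θ t x - θ t y| ≤ D * m ^ lam := h
      _ ≤ D * (δ / (D + 1)) := mul_le_mul_of_nonneg_left hmpow hD0
      _ ≤ δ := hDq
  have : |θ t x - θ t y| ≤ 0 := le_of_forall_pos_le_add fun δ hδ => by
    have := key δ hδ; linarith
  have h0 : |θ t x - θ t y| = 0 := le_antisymm this (abs_nonneg _)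
  exact sub_eq_zero.1 (abs_eq_zero.1 h0)

/-- **COROLLARY U1, space–time form (Liouville).**  A bounded `C²` solution of
`∂ₜθ = Δθ − ⟪b, ∇θ⟫` on `(−∞, 0) × E` with a Type-I drift `‖b(t,x)‖ ≤ C/√(−t)` is CONSTANT in space
AND time: `θ(s,x) = θ(t,y)` for all `s, t < 0` and all `x, y`.  (Every slice is constant by
`typeIDrift_ancient_slice_constant`; on a constant slice `Δθ = 0` and `∇θ = 0`, so the equation gives
`∂ₜθ(·,x) = 0` on the connected open time interval `(−∞,0)`.)
(`pub/ns-exp-scalarLiouville/MAP.md` rev 2 §2 COROLLARY U1, space–time form.)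
[cite: SereginSilvestreSverakZlatos2012, Thm 1.1 (Liouville theorem for bounded ancient solutions with critical drift — Type-I-in-time variant)]
[cite: KochNadirashviliSereginSverak2009, Thm 5.2] -/
theorem typeIDrift_ancient_constant {θ : ℝ → E → ℝ} {b : ℝ → E → E} {C M : ℝ}
    (hθ : ContDiffOn ℝ 2 (uncurry θ) (Iio 0 ×ˢ univ))
    (hM : ∀ t, t < 0 → ∀ x, |θ t x| ≤ M) (hC : 0 ≤ C)
    (hb : ∀ t, t < 0 → ∀ x, ‖b t x‖ ≤ C / Real.sqrt (-t))
    (heq : ∀ t, t < 0 → ∀ x,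
      deriv (fun s => θ s x) t = (Δ (θ t)) x - ⟪b t x, gradient (θ t) x⟫) :
    ∀ s t, s < 0 → t < 0 → ∀ x y : E, θ s x = θ t y := by
  have hslice := typeIDrift_ancient_slice_constant hθ hM hC hb heq
  intro s t hs ht x y
  rw [← hslice t ht x y]
  -- time constancy of `σ ↦ θ σ x` on `(−∞, 0)`
  have hderiv0 : ∀ τ, τ < 0 → deriv (fun σ => θ σ x) τ = 0 := by
    intro τ hτ
    have hfun : θ τ = fun _ => θ τ x := funext fun z => hslice τ hτ z x
    rw [heq τ hτ x, hfun]
    simp [InnerProductSpace.laplacian_const]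
  have hdiff : DifferentiableOn ℝ (fun σ => θ σ x) (Iio 0) := by
    have h1 : ContDiffOn ℝ 2 (fun σ => θ σ x) (Iio 0) :=
      hθ.comp (contDiffOn_id.prodMk contDiffOn_const) fun σ hσ => mk_mem_prod hσ (mem_univ x)
    exact h1.differentiableOn (by norm_num)
  have hfd : (Iio (0 : ℝ)).EqOn (fderiv ℝ (fun σ => θ σ x)) 0 := by
    intro τ hτ
    rw [Pi.zero_apply]
    exact ContinuousLinearMap.ext_ring (by rw [fderiv_apply_one_eq_deriv, hderiv0 τ hτ]; simp)
  exact isOpen_Iio.is_const_of_fderiv_eq_zero isPreconnected_Iio hdiff hfd hs ht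

end Unconditional

end TypeIDrift

end Literature.Analysis.FluidPDE

end
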